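import Literature.MeasureTheory.Group.DiscreteFundamentalDomain
import Mathlib.MeasureTheory.Group.FundamentalDomain
import Mathlib.MeasureTheory.Measure.Regular
import Mathlib.Topology.Algebra.Group.Quotient
import Mathlib.Topology.Algebra.Group.Compact

/-!
# Fundamental domains for discrete subgroups: inside a given set, and relatively compact

Topic `MeasureTheory/Group`. Refinements of `Literature.MeasureTheory.Group.DiscreteFundamentalDomain`
(same construction `strictFundamentalDomain`, same sources: Bourbaki, *Intégration* VII §2 exerc.;
Raghunathan, *Discrete subgroups of Lie groups*, Ch. I):

* `exists_subset_measurableSet_existsUnique` — the abstract theorem WITH A CONSTRAINT SET: a countable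
  group `Γ` acting by measurable maps on a second-countable space `X`, a measurable `K` meeting every
  orbit, and around every point of `K` an open `V` with `γ • V ∩ V = ∅` for `γ ≠ 1`, give a measurable
  `𝓕 ⊆ K` containing EXACTLY ONE point of every orbit (`∀ x, ∃! γ : Γ, γ • x ∈ 𝓕`), hence
  `IsFundamentalDomain Γ 𝓕 μ` for EVERY measure `μ` (`isFundamentalDomain_of_existsUnique`);
* `exists_local_left` / `exists_local_op` — the local separation sets for a DISCRETE subgroup `Γ ≤ G`
  acting on the left and on the right (`Γ.op`): translates of a symmetric open `W ∋ 1` with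
  `W W⁻¹ ∪ W⁻¹ W ⊆ U`, `U ∩ Γ = {1}`; `exists_fundamentalDomain_left_subset` / `_op_subset` and the
  unconstrained corollaries (`_left`, `_op`, measure forms, `hasFundamentalDomain_left/_op`);
* **cocompact refinement** (`[LocallyCompactSpace G] [CompactSpace (G ⧸ Γ)]`): `exists_isCompact_cover_op`
  (a compact closed `K` meeting every right orbit; `_left` for `Γ` normal), hence a RELATIVELY COMPACT
  measurable fundamental domain (`exists_fundamentalDomain_op_relCompact` / `_left_relCompact`) and one
  of FINITE measure for every measure finite on compacts, e.g. every Haar measure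
  (`exists_isFundamentalDomain_op_finite` / `_left_finite`).

Everything is proved (Mathlib + the tree file only).

## Provenance

Reproduced for the tree under the LEAN-IN-TREE rule (2026-08-18) from the pub-hodgecm cell's package file
`HodgeCM/PerL34/DiscreteFundamentalDomain.lean` §§2–4 (DAG-node prover #09 lineage, seat pv09-g4, gate run
25; 401 lines), verbatim up to: the namespace (`HodgeCM.PerL34.DiscreteFD` ↦
`Literature.MeasureTheory.Group.DiscreteSubgroup`); its §1 (the construction `dom`, covered by the tree's
`strictFundamentalDomain`) replaced by the three bridge lemmas of §1 below; `countable_op` an explicit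
theorem instead of an instance; added docstrings.
-/

set_option autoImplicit false

noncomputable section

open _root_.MeasureTheory Set Filter _root_.Topology
open scoped Pointwise

namespace Literature.MeasureTheory.Group.DiscreteSubgroup

/-! ## §1 Bridge to the tree's construction `strictFundamentalDomain` -/

section Construction

variable {Γ : Type*} {X : Type*} [Group Γ] [MulAction Γ X]

/-- The candidate domain built from sets `U n ⊆ K` lies in `K`. [folklore] -/
theorem strictFundamentalDomain_subset {U : ℕ → Set X} {K : Set X} (hUK : ∀ n, U n ⊆ K) :
    strictFundamentalDomain Γ U ⊆ K := by
  intro x hx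
  obtain ⟨i, hi, -⟩ := mem_strictFundamentalDomain_iff.1 hx
  exact hUK i hi

/-- Measurability of the candidate domain for a countable group acting by measurable maps — the
variant of `measurableSet_strictFundamentalDomain` with `[MeasurableConstSMul Γ X]` only (no measurable
structure on `Γ`). [folklore] -/
theorem measurableSet_strictFundamentalDomain' [MeasurableSpace X] [Countable Γ]
    [MeasurableConstSMul Γ X] {U : ℕ → Set X} (hU : ∀ n, MeasurableSet (U n)) :
    MeasurableSet (strictFundamentalDomain Γ U) := by
  refine MeasurableSet.iUnion fun i => (hU i).diff ?_
  refine MeasurableSet.biUnion (Set.to_countable _) fun j _ => ?_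
  exact MeasurableSet.iUnion fun γ => measurable_const_smul _ (hU j)

/-- **Exactly one point of every orbit**, with the separation hypothesis in the form "each `U n` is
moved off itself by every `γ ≠ 1`" and the covering hypothesis "every orbit meets some `U n`"
(from `existsUnique_smul_mem_strictFundamentalDomain`'s proof pattern). [folklore] -/
theorem existsUnique_smul_mem_strictFundamentalDomain' {U : ℕ → Set X}
    (hdisj : ∀ (n : ℕ) (γ : Γ), γ ≠ 1 → Disjoint (γ • U n) (U n))
    (hcov : ∀ x : X, ∃ (γ : Γ) (n : ℕ), γ • x ∈ U n) (x : X) :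
    ∃! γ : Γ, γ • x ∈ strictFundamentalDomain Γ U := by
  classical
  have hsec : ∀ i, ∀ y ∈ U i, ∀ γ : Γ, γ • y ∈ U i → γ = 1 := by
    intro i y hy γ hγ
    by_contra h
    exact Set.disjoint_left.1 (hdisj i γ h) (smul_mem_smul_set hy) hγ
  have hex : ∃ i, ∃ γ : Γ, γ • x ∈ U i := by
    obtain ⟨γ, n, h⟩ := hcov x
    exact ⟨n, γ, h⟩
  set i := Nat.find hex with hi
  obtain ⟨γ₀, hγ₀⟩ : ∃ γ : Γ, γ • x ∈ U i := Nat.find_spec hex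
  have hmin : ∀ j < i, ∀ γ : Γ, γ • x ∉ U j := fun j hj γ hγ =>
    Nat.find_min hex hj ⟨γ, hγ⟩
  refine ⟨γ₀, ?_, fun γ hγ => ?_⟩
  · show γ₀ • x ∈ strictFundamentalDomain Γ U
    rw [mem_strictFundamentalDomain_iff]
    refine ⟨i, hγ₀, fun j hj γ hγ => hmin j hj (γ⁻¹ * γ₀) ?_⟩
    rwa [mul_smul]
  · change γ • x ∈ strictFundamentalDomain Γ U at hγ
    rw [mem_strictFundamentalDomain_iff] at hγ
    obtain ⟨i', hi', hmin'⟩ := hγ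
    have h1 : ¬ i' < i := fun hlt => hmin i' hlt γ hi'
    have h2 : ¬ i < i' := fun hlt => hmin' i hlt (γ * γ₀⁻¹) (by
      rwa [mul_inv_rev, inv_inv, mul_smul, inv_smul_smul])
    have heq : i' = i := le_antisymm (not_lt.1 h2) (not_lt.1 h1)
    rw [heq] at hi'
    have := hsec i (γ₀ • x) hγ₀ (γ * γ₀⁻¹) (by rwa [mul_smul, inv_smul_smul])
    exact mul_inv_eq_one.1 this

/-- The exact-one-representative property gives `IsFundamentalDomain` for EVERY measure
(`MeasureTheory.IsFundamentalDomain.mk'`). [folklore] -/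
theorem isFundamentalDomain_of_existsUnique [MeasurableSpace X] {𝓕 : Set X}
    (h𝓕 : MeasurableSet 𝓕) (h : ∀ x : X, ∃! γ : Γ, γ • x ∈ 𝓕) (μ : Measure X) :
    IsFundamentalDomain Γ 𝓕 μ :=
  IsFundamentalDomain.mk' h𝓕.nullMeasurableSet h

end Construction

/-! ## §2 From local separation data to a fundamental domain -/

section Local

variable {Γ : Type*} {X : Type*} [Group Γ] [MulAction Γ X] [TopologicalSpace X]

/-- A countable family of open sets, each moved off itself by every `γ ≠ 1`, covering `K`. [folklore] -/
theorem exists_seq [SecondCountableTopology X] {K : Set X}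
    (hV : ∀ x ∈ K, ∃ V : Set X, IsOpen V ∧ x ∈ V ∧ ∀ γ : Γ, γ ≠ 1 → Disjoint (γ • V) V) :
    ∃ u : ℕ → Set X, (∀ n, IsOpen (u n)) ∧
      (∀ (n : ℕ) (γ : Γ), γ ≠ 1 → Disjoint (γ • u n) (u n)) ∧ K ⊆ ⋃ n, u n := by
  rcases K.eq_empty_or_nonempty with rfl | hK
  · exact ⟨fun _ => ∅, fun _ => isOpen_empty, fun n γ _ => by simp, empty_subset _⟩
  have hV' : ∀ x : K, ∃ V : Set X, IsOpen V ∧ (x : X) ∈ V ∧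
      ∀ γ : Γ, γ ≠ 1 → Disjoint (γ • V) V := fun x => hV x x.2
  choose V hVo hxV hVd using hV'
  obtain ⟨T, hTc, hTU⟩ := TopologicalSpace.isOpen_iUnion_countable V hVo
  haveI : Nonempty K := hK.to_subtype
  obtain ⟨f, hf⟩ := Set.countable_iff_exists_subset_range.1 hTc
  refine ⟨fun n => V (f n), fun n => hVo _, fun n γ hγ => hVd _ γ hγ, fun x hx => ?_⟩
  have hxU : x ∈ ⋃ i ∈ T, V i := by
    rw [hTU]
    exact mem_iUnion.2 ⟨⟨x, hx⟩, hxV _⟩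
  obtain ⟨i, hi, hxi⟩ := mem_iUnion₂.1 hxU
  obtain ⟨n, rfl⟩ := hf hi
  exact mem_iUnion.2 ⟨n, hxi⟩

/-- **Abstract existence theorem.**  A countable group acting measurably on a second countable
space, a measurable `K` meeting every orbit, and local separation at the points of `K` give a
measurable `𝓕 ⊆ K` meeting every orbit in exactly one point. [folklore] -/
theorem exists_subset_measurableSet_existsUnique [SecondCountableTopology X]
    [MeasurableSpace X] [OpensMeasurableSpace X] [Countable Γ] [MeasurableConstSMul Γ X]
    {K : Set X} (hKm : MeasurableSet K) (hKcov : ∀ x : X, ∃ γ : Γ, γ • x ∈ K)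
    (hV : ∀ x ∈ K, ∃ V : Set X, IsOpen V ∧ x ∈ V ∧ ∀ γ : Γ, γ ≠ 1 → Disjoint (γ • V) V) :
    ∃ 𝓕 : Set X, 𝓕 ⊆ K ∧ MeasurableSet 𝓕 ∧ ∀ x : X, ∃! γ : Γ, γ • x ∈ 𝓕 := by
  obtain ⟨u, huo, hud, hKu⟩ := exists_seq (Γ := Γ) hV
  refine ⟨strictFundamentalDomain Γ (fun n => u n ∩ K),
    strictFundamentalDomain_subset fun n => inter_subset_right,
    measurableSet_strictFundamentalDomain' fun n => (huo n).measurableSet.inter hKm,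
    existsUnique_smul_mem_strictFundamentalDomain' (fun n γ hγ => ?_) (fun x => ?_)⟩
  · exact (hud n γ hγ).mono (smul_set_mono inter_subset_left) inter_subset_left
  · obtain ⟨γ, hγ⟩ := hKcov x
    obtain ⟨n, hn⟩ := mem_iUnion.1 (hKu hγ)
    exact ⟨γ, n, hn, hγ⟩

end Local

/-! ## §3 Discrete subgroups of topological groups -/

section Group

variable {G : Type*} [Group G] [TopologicalSpace G]

/-- A discrete subgroup of a second countable space is countable. [folklore] -/
theorem countable_of_discrete [SecondCountableTopology G] (Γ : Subgroup G) [DiscreteTopology Γ] :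
    Countable Γ :=
  TopologicalSpace.separableSpace_iff_countable.1 inferInstance

/-- The opposite of a discrete subgroup of a second countable group is countable. [folklore] -/
theorem countable_op [SecondCountableTopology G] (Γ : Subgroup G) [DiscreteTopology Γ] :
    Countable Γ.op :=
  haveI := countable_of_discrete Γ
  Countable.of_equiv _ Γ.equivOp

/-- A discrete subgroup meets some neighbourhood of `1` only in `1`. [folklore] -/
theorem exists_nhds_one_eq_one (Γ : Subgroup G) [DiscreteTopology Γ] :
    ∃ U ∈ 𝓝 (1 : G), ∀ γ : Γ, (γ : G) ∈ U → γ = 1 := by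
  obtain ⟨U, hUo, hU⟩ := isOpen_induced_iff.1 (isOpen_discrete ({1} : Set Γ))
  refine ⟨U, hUo.mem_nhds ?_, fun γ hγ => ?_⟩
  · have h : (1 : Γ) ∈ ((↑) : Γ → G) ⁻¹' U := by
      rw [hU]
      exact rfl
    exact h
  · have h : γ ∈ ((↑) : Γ → G) ⁻¹' U := hγ
    rw [hU] at h
    exact h

variable [IsTopologicalGroup G]

/-- A symmetric open neighbourhood `W` of `1` with `W W⁻¹ ⊆ U` and `W⁻¹ W ⊆ U`. [folklore] -/
theorem exists_open_symm_nhds {U : Set G} (hU : U ∈ 𝓝 (1 : G)) :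
    ∃ W : Set G, IsOpen W ∧ (1 : G) ∈ W ∧ (∀ a ∈ W, ∀ b ∈ W, a * b⁻¹ ∈ U) ∧
      ∀ a ∈ W, ∀ b ∈ W, a⁻¹ * b ∈ U := by
  obtain ⟨V, hV, hVU⟩ := exists_nhds_split_inv hU
  refine ⟨interior V ∩ (interior V)⁻¹, isOpen_interior.inter isOpen_interior.inv,
    ⟨mem_interior_iff_mem_nhds.2 hV, ?_⟩, fun a ha b hb => ?_, fun a ha b hb => ?_⟩
  · show (1 : G)⁻¹ ∈ interior V
    rw [inv_one]
    exact mem_interior_iff_mem_nhds.2 hV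
  · simpa [div_eq_mul_inv] using hVU a (interior_subset ha.1) b (interior_subset hb.1)
  · have ha' : a⁻¹ ∈ interior V := ha.2
    have hb' : b⁻¹ ∈ interior V := hb.2
    simpa [div_eq_mul_inv] using hVU a⁻¹ (interior_subset ha') b⁻¹ (interior_subset hb')

/-- Local separation for the LEFT action of a discrete subgroup. [folklore] -/
theorem exists_local_left (Γ : Subgroup G) [DiscreteTopology Γ] (x : G) :
    ∃ V : Set G, IsOpen V ∧ x ∈ V ∧ ∀ γ : Γ, γ ≠ 1 → Disjoint (γ • V) V := by
  obtain ⟨U, hU, hU1⟩ := exists_nhds_one_eq_one Γ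
  obtain ⟨W, hWo, hW1, hWr, -⟩ := exists_open_symm_nhds hU
  refine ⟨(fun w => w * x) '' W, isOpenMap_mul_right x W hWo, ⟨1, hW1, one_mul x⟩,
    fun γ hγ => Set.disjoint_left.2 ?_⟩
  rintro z hz ⟨b, hb, rfl⟩
  obtain ⟨y, ⟨a, ha, rfl⟩, hy⟩ := mem_smul_set.1 hz
  apply hγ
  apply hU1
  rw [Subgroup.smul_def, smul_eq_mul] at hy
  have : (γ : G) = b * a⁻¹ := by
    calc (γ : G) = (γ : G) * (a * x) * (a * x)⁻¹ := by group
    _ = b * a⁻¹ := by rw [hy]; group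
  rw [this]
  exact hWr b hb a ha

/-- Local separation for the RIGHT action (`Γ.op`) of a discrete subgroup. [folklore] -/
theorem exists_local_op (Γ : Subgroup G) [DiscreteTopology Γ] (x : G) :
    ∃ V : Set G, IsOpen V ∧ x ∈ V ∧ ∀ γ : Γ.op, γ ≠ 1 → Disjoint (γ • V) V := by
  obtain ⟨U, hU, hU1⟩ := exists_nhds_one_eq_one Γ
  obtain ⟨W, hWo, hW1, -, hWl⟩ := exists_open_symm_nhds hU
  refine ⟨(fun w => x * w) '' W, isOpenMap_mul_left x W hWo, ⟨1, hW1, mul_one x⟩,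
    fun γ hγ => Set.disjoint_left.2 ?_⟩
  rintro z hz ⟨b, hb, rfl⟩
  obtain ⟨y, ⟨a, ha, rfl⟩, hy⟩ := mem_smul_set.1 hz
  have hmem : MulOpposite.unop (γ : Gᵐᵒᵖ) ∈ Γ := Subgroup.mem_op.1 γ.2
  apply hγ
  rw [Subgroup.smul_def, MulOpposite.smul_eq_mul_unop] at hy
  have hval : MulOpposite.unop (γ : Gᵐᵒᵖ) = a⁻¹ * b := by
    calc MulOpposite.unop (γ : Gᵐᵒᵖ)
        = (x * a)⁻¹ * ((x * a) * MulOpposite.unop (γ : Gᵐᵒᵖ)) := by group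
    _ = a⁻¹ * b := by rw [hy]; group
  have h1 : (⟨MulOpposite.unop (γ : Gᵐᵒᵖ), hmem⟩ : Γ) = 1 := by
    apply hU1
    show MulOpposite.unop (γ : Gᵐᵒᵖ) ∈ U
    rw [hval]
    exact hWl a ha b hb
  have h2 : MulOpposite.unop (γ : Gᵐᵒᵖ) = 1 := congrArg Subtype.val h1
  exact Subtype.ext ((MulOpposite.unop_eq_one_iff _).1 h2)

/-! ### Compact sets meeting every orbit of a cocompact subgroup -/

/-- If `G ⧸ Γ` is compact, some compact closed `K ⊆ G` meets every right `Γ`-orbit. [folklore] -/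
theorem exists_isCompact_cover_op [LocallyCompactSpace G] (Γ : Subgroup G)
    [CompactSpace (G ⧸ Γ)] :
    ∃ K : Set G, IsCompact K ∧ IsClosed K ∧ ∀ x : G, ∃ γ : Γ.op, γ • x ∈ K := by
  have hK : ∀ x : G, ∃ K : Set G, IsCompact K ∧ K ∈ 𝓝 x := fun x => exists_compact_mem_nhds x
  choose K hKc hKn using hK
  have hcov : (univ : Set (G ⧸ Γ)) ⊆
      ⋃ x : G, (QuotientGroup.mk : G → G ⧸ Γ) '' interior (K x) := by
    rintro q -
    obtain ⟨x, rfl⟩ := QuotientGroup.mk_surjective q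
    exact mem_iUnion.2 ⟨x, x, mem_interior_iff_mem_nhds.2 (hKn x), rfl⟩
  obtain ⟨t, ht⟩ := isCompact_univ.elim_finite_subcover
    (fun x : G => (QuotientGroup.mk : G → G ⧸ Γ) '' interior (K x))
    (fun x => QuotientGroup.isOpenMap_coe _ isOpen_interior) hcov
  refine ⟨closure (⋃ x ∈ t, K x), (t.isCompact_biUnion fun x _ => hKc x).closure,
    isClosed_closure, fun y => ?_⟩
  obtain ⟨x, hx, hy⟩ := mem_iUnion₂.1 (ht (mem_univ (QuotientGroup.mk y)))
  obtain ⟨k, hk, hky⟩ := hy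
  have hmem : k⁻¹ * y ∈ Γ := QuotientGroup.eq.1 hky
  have hmem' : MulOpposite.op (k⁻¹ * y)⁻¹ ∈ Γ.op := Subgroup.mem_op.2 (Γ.inv_mem hmem)
  refine ⟨⟨MulOpposite.op (k⁻¹ * y)⁻¹, hmem'⟩, ?_⟩
  have hval : (⟨MulOpposite.op (k⁻¹ * y)⁻¹, hmem'⟩ : Γ.op) • y = k := by
    rw [Subgroup.mk_smul, op_smul_eq_mul]
    group
  rw [hval]
  exact subset_closure (mem_iUnion₂.2 ⟨x, hx, interior_subset hk⟩)

/-- If `G ⧸ Γ` is compact and `Γ` is normal (e.g. `G` commutative), some compact closed `K ⊆ G`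
meets every left `Γ`-orbit. [folklore] -/
theorem exists_isCompact_cover_left [LocallyCompactSpace G] (Γ : Subgroup G) [Γ.Normal]
    [CompactSpace (G ⧸ Γ)] :
    ∃ K : Set G, IsCompact K ∧ IsClosed K ∧ ∀ x : G, ∃ γ : Γ, γ • x ∈ K := by
  obtain ⟨K, hKc, hKcl, hK⟩ := exists_isCompact_cover_op Γ
  refine ⟨K, hKc, hKcl, fun y => ?_⟩
  obtain ⟨γ, hγ⟩ := hK y
  have hg : MulOpposite.unop (γ : Gᵐᵒᵖ) ∈ Γ := Subgroup.mem_op.1 γ.2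
  refine ⟨⟨y * MulOpposite.unop (γ : Gᵐᵒᵖ) * y⁻¹,
    (inferInstance : Γ.Normal).conj_mem _ hg y⟩, ?_⟩
  rw [Subgroup.smul_def, MulOpposite.smul_eq_mul_unop] at hγ
  rw [Subgroup.mk_smul, smul_eq_mul]
  simpa [mul_assoc] using hγ

variable [SecondCountableTopology G] [MeasurableSpace G] [BorelSpace G]

/-- **Existence, left action, inside a covering measurable set `K`.** [folklore] -/
theorem exists_fundamentalDomain_left_subset (Γ : Subgroup G) [DiscreteTopology Γ]
    {K : Set G} (hKm : MeasurableSet K) (hKcov : ∀ x : G, ∃ γ : Γ, γ • x ∈ K) :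
    ∃ 𝓕 : Set G, 𝓕 ⊆ K ∧ MeasurableSet 𝓕 ∧ ∀ x : G, ∃! γ : Γ, γ • x ∈ 𝓕 := by
  haveI := countable_of_discrete Γ
  exact exists_subset_measurableSet_existsUnique hKm hKcov fun x _ => exists_local_left Γ x

/-- **Existence, left action.**  A discrete subgroup of a second countable topological group has a
measurable fundamental domain in the exact sense `∀ x, ∃! γ : Γ, γ • x ∈ 𝓕`. [folklore] -/
theorem exists_fundamentalDomain_left (Γ : Subgroup G) [DiscreteTopology Γ] :
    ∃ 𝓕 : Set G, MeasurableSet 𝓕 ∧ ∀ x : G, ∃! γ : Γ, γ • x ∈ 𝓕 := by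
  obtain ⟨𝓕, -, h⟩ := exists_fundamentalDomain_left_subset Γ MeasurableSet.univ
    (fun x => ⟨1, mem_univ _⟩)
  exact ⟨𝓕, h⟩

/-- **Existence, right action (`Γ.op`), inside a covering measurable set `K`.** [folklore] -/
theorem exists_fundamentalDomain_op_subset (Γ : Subgroup G) [DiscreteTopology Γ]
    {K : Set G} (hKm : MeasurableSet K) (hKcov : ∀ x : G, ∃ γ : Γ.op, γ • x ∈ K) :
    ∃ 𝓕 : Set G, 𝓕 ⊆ K ∧ MeasurableSet 𝓕 ∧ ∀ x : G, ∃! γ : Γ.op, γ • x ∈ 𝓕 :=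
  haveI := countable_op Γ
  exists_subset_measurableSet_existsUnique hKm hKcov fun x _ => exists_local_op Γ x

/-- **Existence, right action (`Γ.op`).** [folklore] -/
theorem exists_fundamentalDomain_op (Γ : Subgroup G) [DiscreteTopology Γ] :
    ∃ 𝓕 : Set G, MeasurableSet 𝓕 ∧ ∀ x : G, ∃! γ : Γ.op, γ • x ∈ 𝓕 := by
  obtain ⟨𝓕, -, h⟩ := exists_fundamentalDomain_op_subset Γ MeasurableSet.univ
    (fun x => ⟨1, mem_univ _⟩)
  exact ⟨𝓕, h⟩

/-- Measure form, left action: `IsFundamentalDomain Γ 𝓕 μ` for every measure `μ`. [folklore] -/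
theorem exists_isFundamentalDomain_left (Γ : Subgroup G) [DiscreteTopology Γ] :
    ∃ 𝓕 : Set G, MeasurableSet 𝓕 ∧ ∀ μ : Measure G, IsFundamentalDomain Γ 𝓕 μ := by
  obtain ⟨𝓕, h𝓕m, h⟩ := exists_fundamentalDomain_left Γ
  exact ⟨𝓕, h𝓕m, fun μ => isFundamentalDomain_of_existsUnique h𝓕m h μ⟩

/-- Measure form, right action: `IsFundamentalDomain Γ.op 𝓕 μ` for every measure `μ`. [folklore] -/
theorem exists_isFundamentalDomain_op (Γ : Subgroup G) [DiscreteTopology Γ] :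
    ∃ 𝓕 : Set G, MeasurableSet 𝓕 ∧ ∀ μ : Measure G, IsFundamentalDomain Γ.op 𝓕 μ := by
  obtain ⟨𝓕, h𝓕m, h⟩ := exists_fundamentalDomain_op Γ
  exact ⟨𝓕, h𝓕m, fun μ => isFundamentalDomain_of_existsUnique h𝓕m h μ⟩

/-- Mathlib's class `HasFundamentalDomain Γ G μ` for a discrete subgroup, every measure. [folklore]
-/
theorem hasFundamentalDomain_left (Γ : Subgroup G) [DiscreteTopology Γ] (μ : Measure G) :
    HasFundamentalDomain Γ G μ := by
  obtain ⟨𝓕, -, h⟩ := exists_isFundamentalDomain_left Γ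
  exact ⟨⟨𝓕, h μ⟩⟩

/-- Mathlib's class `HasFundamentalDomain Γ.op G μ` for a discrete subgroup, every measure.
[folklore] -/
theorem hasFundamentalDomain_op (Γ : Subgroup G) [DiscreteTopology Γ] (μ : Measure G) :
    HasFundamentalDomain Γ.op G μ := by
  obtain ⟨𝓕, -, h⟩ := exists_isFundamentalDomain_op Γ
  exact ⟨⟨𝓕, h μ⟩⟩

/-! ## §4 Cocompact discrete subgroups: relatively compact fundamental domains -/

variable [LocallyCompactSpace G]

/-- **Cocompact case, right action.**  A relatively compact measurable fundamental domain. [folklore] -/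
theorem exists_fundamentalDomain_op_relCompact (Γ : Subgroup G) [DiscreteTopology Γ]
    [CompactSpace (G ⧸ Γ)] :
    ∃ 𝓕 : Set G, MeasurableSet 𝓕 ∧ IsCompact (closure 𝓕) ∧
      ∀ x : G, ∃! γ : Γ.op, γ • x ∈ 𝓕 := by
  obtain ⟨K, hKc, hKcl, hK⟩ := exists_isCompact_cover_op Γ
  obtain ⟨𝓕, h𝓕K, h𝓕m, h⟩ := exists_fundamentalDomain_op_subset Γ hKcl.measurableSet hK
  exact ⟨𝓕, h𝓕m, hKc.of_isClosed_subset isClosed_closure (closure_minimal h𝓕K hKcl), h⟩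

/-- **Cocompact case, left action, `Γ` normal.** [folklore] -/
theorem exists_fundamentalDomain_left_relCompact (Γ : Subgroup G) [DiscreteTopology Γ]
    [Γ.Normal] [CompactSpace (G ⧸ Γ)] :
    ∃ 𝓕 : Set G, MeasurableSet 𝓕 ∧ IsCompact (closure 𝓕) ∧
      ∀ x : G, ∃! γ : Γ, γ • x ∈ 𝓕 := by
  obtain ⟨K, hKc, hKcl, hK⟩ := exists_isCompact_cover_left Γ
  obtain ⟨𝓕, h𝓕K, h𝓕m, h⟩ := exists_fundamentalDomain_left_subset Γ hKcl.measurableSet hK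
  exact ⟨𝓕, h𝓕m, hKc.of_isClosed_subset isClosed_closure (closure_minimal h𝓕K hKcl), h⟩

/-- Measure form of the cocompact case, right action: a measurable fundamental domain of finite
measure for every measure finite on compact sets (every Haar measure). [folklore] -/
theorem exists_isFundamentalDomain_op_finite (Γ : Subgroup G) [DiscreteTopology Γ]
    [CompactSpace (G ⧸ Γ)] (μ : Measure G) [IsFiniteMeasureOnCompacts μ] :
    ∃ 𝓕 : Set G, MeasurableSet 𝓕 ∧ IsFundamentalDomain Γ.op 𝓕 μ ∧
      IsCompact (closure 𝓕) ∧ μ 𝓕 < ⊤ := by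
  obtain ⟨𝓕, h𝓕m, hc, h⟩ := exists_fundamentalDomain_op_relCompact Γ
  exact ⟨𝓕, h𝓕m, isFundamentalDomain_of_existsUnique h𝓕m h μ, hc,
    (measure_mono subset_closure).trans_lt hc.measure_lt_top⟩

/-- Measure form of the cocompact case, left action, `Γ` normal. [folklore] -/
theorem exists_isFundamentalDomain_left_finite (Γ : Subgroup G) [DiscreteTopology Γ]
    [Γ.Normal] [CompactSpace (G ⧸ Γ)] (μ : Measure G) [IsFiniteMeasureOnCompacts μ] :
    ∃ 𝓕 : Set G, MeasurableSet 𝓕 ∧ IsFundamentalDomain Γ 𝓕 μ ∧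
      IsCompact (closure 𝓕) ∧ μ 𝓕 < ⊤ := by
  obtain ⟨𝓕, h𝓕m, hc, h⟩ := exists_fundamentalDomain_left_relCompact Γ
  exact ⟨𝓕, h𝓕m, isFundamentalDomain_of_existsUnique h𝓕m h μ, hc,
    (measure_mono subset_closure).trans_lt hc.measure_lt_top⟩

end Group

end Literature.MeasureTheory.Group.DiscreteSubgroup
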